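import Mathlib
import Literature.Probability.LatticeModels.TorusHeatKernel1D
import Literature.MathematicalPhysics.QuantumFieldTheory.Balaban1983to89.B12Decay510Torus
import Summits.QuantumFields.BalabanUV.T4Continuum.Support.SliceTorusBlocks
import Summits.QuantumFields.BalabanUV.T4Continuum.Support.SliceFlatHeatWeighted

/-!
# T⁴ programme, node NE3 (η-rate of the minimisers) — THE FLAT RUNG, part 9: the weighted heat-kernel bounds PERIODISED to
# the discrete circle `ℤ/P`, LOCALISED to blocks of side `n`, and MULTIPLIED over the coordinates of the torus `(ℤ/P)^{d+1}`

Fifteenth generation of the NE3 prover lineage P1 of the cell `pub-balaban`, file 3 of the free-gradient chain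
(`SliceFlatHeatOneDim → SliceFlatHeatWeighted → SliceFlatHeatTorus → SliceFlatFreeResolvent → SliceFlatGradient`; end point: the
flat `hT31` item 1 of the lineage's one type p199789).  Inputs BY NAME: the weighted ℓ¹ bounds on `ℤ` of part 8
(`weighted_tsum_srw_le`, `weighted_tsum_fwdDiff_srw_le`), the tree's torus heat kernel `torusHeatKernel t (c : ZMod P) = q^P_t(c)`
with its METHOD OF IMAGES `TorusHeatKernel1D.torusHeatKernel_eq_tsum` (`q^P_t(r̄) = Σ_{w∈ℤ} q_t(r + wP)`), and the lineage's
block bookkeeping `SliceTorusBlocks.blockOf ∕ blockPt ∕ npl1` with the cell's periodic absolute value `B12Decay510Torus.pabs`.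
 * §1 PERIODISATION IS A WEIGHTED ℓ¹ CONTRACTION (`sum_weight_abs_periodic_le`): for a weight `w ≥ 0` on `ℤ` with
   `w(r) ≤ w(r + kP)` whenever `2|r| ≤ P`, `Σ_{c ∈ ℤ/P} w(c̃)·|Σ_k f(c̃ + kP)| ≤ Σ_{m∈ℤ} w(m)|f(m)|` (`c̃ = valMinAbs c`; the
   map `(c, k) ↦ c̃ + kP` is injective);
 * §2 the torus forms `Σ_c e^{β|c̃|}|q^P_t(c)| ≤ 48e^{4β²T}` (`0 ≤ β ≤ 1/16`) and
   `Σ_c e^{β|c̃|}|q^P_t(c+1) − q^P_t(c)| ≤ 1260·T^{−1/2}e^{8β²T}` (`0 ≤ β ≤ 1/32`), `T = 1 ∨ t`, uniformly in `P`;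
 * §3 BLOCKS: the reverse distance dictionary `n·|βx − βz|_Q ≤ |x − z|_P + (n − 1)` (`P = Q·n`, `β = blockOf Q n`; companion of
   `SliceTorusBlocks.pabs_sub_le_blockOf`) and the block-localised form of a weighted bound:
   `Σ_{c : βc = b} |K(x − c)| ≤ e^{α}·e^{−α|βx − b|_Q}·Σ_c e^{(α/n)|c̃|}|K(c)|`;
 * §4 THE PRODUCT OVER COORDINATES (`blockSum_rowDiff_prodHeat_le`): for the product kernel `H_t(x,z) = Π_i q^P_t(x_i − z_i)` on
   `(ℤ/P)^{d+1}` and its unit row difference in direction `ν`,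
   `Σ_{z : blockPt z = y₁} |H_t(x+e_ν,z) − H_t(x,z)| ≤ 1260·48^d·e^{α(d+1)}·T^{−1/2}·e^{8(d+1)(α/n)²T}·e^{−α·npl1(blockPt x − y₁)}`
   for `0 ≤ α ≤ 1/32` — ONE factor `T^{−1/2}`, EXPONENTIAL decay in the integer ℓ¹ block distance, constants free of `n, P, t`.
Honest framing: finite-T⁴ ultraviolet bookkeeping about MINIMISERS (rung (B)+1 of the cell's ladder); no conditional of the
cell (`BetaPertH`, (B), (B^μ)) is used or hidden; nothing bears on infinite volume, a mass gap, or the Clay problem; NE3 is NOT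
proved by this file.  ABSOLUTE RULE of the cell kept: inputs are Mathlib and kernel-proved tree modules only; every declaration
is a [model] definition-free [folklore] theorem; no `def … : Prop`, no `sorry`, no axioms beyond Mathlib's.  PLACEMENT (human
rule 2026-08-19): cell work under `Summits/QuantumFields/BalabanUV/`; moves nothing.  Records: `t4/T4-EST-U1b-OSC.md` v1.32,
`t4/T4-EST-NE3-P1.md` v2.31 of the cell `pub-balaban`.
-/

noncomputable section

open Real Finset Filter

namespace Summit.QuantumFields.BalabanUV.T4Continuum.SliceFlatHeatTorus

open Literature.Probability.LatticeModels
open Literature.MathematicalPhysics.QuantumFieldTheory.Balaban1983to89.B12Decay510Torus (pabs pabs_eq_natAbs pabs_nonneg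
  pabs_le_abs_of_cast_eq exists_eq_add_mul_of_cast_eq pl1_eq_sum)
open Summit.QuantumFields.BalabanUV.T4Continuum.SliceTorusBlocks
open Summit.QuantumFields.BalabanUV.T4Continuum.SliceFlatHeatOneDim
open Summit.QuantumFields.BalabanUV.T4Continuum.SliceFlatHeatWeighted

/-! ## §1  Periodisation is a weighted ℓ¹ contraction -/
section Periodise

variable {P : ℕ} [NeZero P]

/-- The centred representative is the shortest: `|c̃| ≤ |c̃ + kP|` for every `k ∈ ℤ` (`2|c̃| ≤ P`). [folklore] -/
theorem abs_valMinAbs_le_abs_add_mul (c : ZMod P) (k : ℤ) :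
    |(c.valMinAbs : ℤ)| ≤ |c.valMinAbs + k * P| := by
  have h2 := two_mul_abs_valMinAbs_le (L := P) c
  rcases eq_or_ne k 0 with hk | hk
  · simp [hk]
  · have hk1 : (1 : ℤ) ≤ |k| := Int.one_le_abs hk
    have hP0 : (0 : ℤ) ≤ P := by positivity
    have hkP : (P : ℤ) ≤ |k * (P : ℤ)| := by rw [abs_mul, abs_of_nonneg hP0]; nlinarith
    have htri : |k * (P : ℤ)| ≤ |c.valMinAbs + k * P| + |c.valMinAbs| := by
      have := abs_add_le (c.valMinAbs + k * P) (-c.valMinAbs)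
      rwa [add_neg_cancel_comm, abs_neg] at this
    linarith

omit [NeZero P] in
/-- The residue class of `c̃ + kP` is `c`. [folklore] -/
theorem cast_valMinAbs_add_mul (c : ZMod P) (k : ℤ) : (((c.valMinAbs + k * P : ℤ)) : ZMod P) = c := by
  push_cast
  simp

omit [NeZero P] in
/-- An integer in the class of `c` is `c̃ + kP`. [folklore] -/
theorem exists_eq_valMinAbs_add_mul {c : ZMod P} {m : ℤ} (h : ((m : ℤ) : ZMod P) = c) : ∃ k : ℤ, m = c.valMinAbs + k * P := by
  have h' : (((c.valMinAbs : ℤ)) : ZMod P) = ((m : ℤ) : ZMod P) := by rw [ZMod.coe_valMinAbs, h]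
  exact exists_eq_add_mul_of_cast_eq h'

/-- **PERIODISATION IS A WEIGHTED ℓ¹ CONTRACTION.**  Let `w ≥ 0` be a weight on `ℤ` that does not decrease from a centred
representative to the other members of its class (`w(c̃) ≤ w(c̃ + kP)`), `f : ℤ → ℝ` with `Σ|f|`, `Σ w|f|` finite, and let `F(c)` be
the periodisation `Σ_k f(c̃ + kP)`.  Then `Σ_{c ∈ ℤ/P} w(c̃)|F(c)| ≤ Σ_{m ∈ ℤ} w(m)|f(m)|`. [folklore] -/
theorem sum_weight_abs_periodic_le (w f : ℤ → ℝ) (F : ZMod P → ℝ) (hw0 : ∀ m, 0 ≤ w m)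
    (hwmono : ∀ (c : ZMod P) (k : ℤ), w c.valMinAbs ≤ w (c.valMinAbs + k * P))
    (hfa : Summable fun m => |f m|) (hfw : Summable fun m => w m * |f m|)
    (hF : ∀ c : ZMod P, HasSum (fun k : ℤ => f (c.valMinAbs + k * P)) (F c)) :
    ∑ c : ZMod P, w c.valMinAbs * |F c| ≤ ∑' m : ℤ, w m * |f m| := by
  classical
  have hP0 : (P : ℤ) ≠ 0 := by exact_mod_cast NeZero.ne P
  set g : ℤ → ℝ := fun m => w m * |f m| with hg
  have hg0 : ∀ m, 0 ≤ g m := fun m => mul_nonneg (hw0 m) (abs_nonneg _)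
  set gc : ZMod P → ℤ → ℝ := fun c m => if ((m : ℤ) : ZMod P) = c then g m else 0 with hgc
  have hinj : ∀ c : ZMod P, Function.Injective fun k : ℤ => c.valMinAbs + k * P := fun c a b hab => by
    have : a * (P : ℤ) = b * P := by simpa using hab
    exact mul_right_cancel₀ hP0 this
  have hgc_sum : ∀ c : ZMod P, Summable (gc c) := fun c =>
    Summable.of_nonneg_of_le (fun m => by simp only [hgc]; split_ifs <;> [exact hg0 m; exact le_rfl])
      (fun m => by simp only [hgc]; split_ifs <;> [exact le_rfl; exact hg0 m]) hfw
  have hclass : ∀ c : ZMod P, w c.valMinAbs * |F c| ≤ ∑' m, gc c m := by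
    intro c
    have hsa : Summable fun k : ℤ => |f (c.valMinAbs + k * P)| :=
      (hfa.comp_injective (hinj c))
    have h1 : |F c| ≤ ∑' k : ℤ, |f (c.valMinAbs + k * P)| := by
      rw [← (hF c).tsum_eq]
      have hsa' : Summable fun k : ℤ => ‖f (c.valMinAbs + k * P)‖ := by simpa [Real.norm_eq_abs] using hsa
      have := norm_tsum_le_tsum_norm hsa'
      simpa [Real.norm_eq_abs] using this
    have h2 : w c.valMinAbs * ∑' k : ℤ, |f (c.valMinAbs + k * P)| = ∑' k : ℤ, w c.valMinAbs * |f (c.valMinAbs + k * P)| :=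
      (tsum_mul_left).symm
    have hsw : Summable fun k : ℤ => g (c.valMinAbs + k * P) := hfw.comp_injective (hinj c)
    have h3 : ∑' k : ℤ, w c.valMinAbs * |f (c.valMinAbs + k * P)| ≤ ∑' k : ℤ, g (c.valMinAbs + k * P) :=
      Summable.tsum_le_tsum (fun k => mul_le_mul_of_nonneg_right (hwmono c k) (abs_nonneg _)) (hsa.mul_left _) hsw
    have h4 : ∑' k : ℤ, g (c.valMinAbs + k * P) = ∑' m : ℤ, gc c m := by
      have hcomp : (fun k : ℤ => gc c (c.valMinAbs + k * P)) = fun k => g (c.valMinAbs + k * P) := by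
        funext k; simp only [hgc, cast_valMinAbs_add_mul, if_true]
      rw [← hcomp]
      refine Function.Injective.tsum_eq (hinj c) fun m hm => ?_
      have hmc : ((m : ℤ) : ZMod P) = c := by
        by_contra hne
        exact hm (by simp only [hgc, if_neg hne])
      obtain ⟨k, hk⟩ := exists_eq_valMinAbs_add_mul hmc
      exact ⟨k, hk.symm⟩
    calc w c.valMinAbs * |F c| ≤ w c.valMinAbs * ∑' k : ℤ, |f (c.valMinAbs + k * P)| :=
          mul_le_mul_of_nonneg_left h1 (hw0 _)
      _ = _ := h2
      _ ≤ _ := h3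
      _ = _ := h4
  calc ∑ c : ZMod P, w c.valMinAbs * |F c| ≤ ∑ c : ZMod P, ∑' m, gc c m := Finset.sum_le_sum fun c _ => hclass c
    _ = ∑' m, ∑ c : ZMod P, gc c m := (Summable.tsum_finsetSum fun c _ => hgc_sum c).symm
    _ = ∑' m, g m := by
        refine tsum_congr fun m => ?_
        simp only [hgc]
        rw [Finset.sum_ite_eq]
        simp

end Periodise

/-! ## §2  The weighted bounds for the torus heat kernel and its forward difference -/
section TorusKernel

variable {P : ℕ} [NeZero P]

/-- The exponential weight `e^{β|m|}`, `β ≥ 0`, is smallest at the centred representative. [folklore] -/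
theorem expWeight_mono {β : ℝ} (hβ : 0 ≤ β) (c : ZMod P) (k : ℤ) :
    Real.exp (β * |((c.valMinAbs : ℤ) : ℝ)|) ≤ Real.exp (β * |((c.valMinAbs + k * P : ℤ) : ℝ)|) := by
  refine Real.exp_le_exp.2 (mul_le_mul_of_nonneg_left ?_ hβ)
  have h := abs_valMinAbs_le_abs_add_mul c k
  rw [← Int.cast_abs, ← Int.cast_abs]
  exact_mod_cast h

/-- **`Σ_{c ∈ ℤ/P} e^{β|c̃|}|q^P_t(c)| ≤ 48·e^{4β²T}`** for `t > 0`, `0 ≤ β ≤ 1/16`, `T = 1 ∨ t`, uniformly in `P`. [folklore] -/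
theorem weighted_sum_torusHeatKernel_le {t : ℝ} (ht : 0 < t) {β : ℝ} (hβ0 : 0 ≤ β) (hβ : β ≤ 1 / 16) :
    ∑ c : ZMod P, Real.exp (β * |((c.valMinAbs : ℤ) : ℝ)|) * |torusHeatKernel t c| ≤ 48 * Real.exp (4 * β ^ 2 * max 1 t) := by
  obtain ⟨hS0, -⟩ := weighted_tsum_srw_le ht (show (0 : ℝ) ≤ 1 / 16 by norm_num)
  obtain ⟨hSw, hBw⟩ := weighted_tsum_srw_le ht hβ
  have hfa : Summable fun m : ℤ => |srwHeatKernel t m| := by simpa using hS0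
  refine le_trans ?_ hBw
  refine sum_weight_abs_periodic_le (fun m : ℤ => Real.exp (β * |(m : ℝ)|)) (srwHeatKernel t) (torusHeatKernel t)
    (fun m => (Real.exp_pos _).le) (fun c k => expWeight_mono hβ0 c k) hfa hSw fun c => ?_
  obtain ⟨hs, heq⟩ := torusHeatKernel_eq_tsum (L := P) ht c.valMinAbs
  rw [ZMod.coe_valMinAbs] at heq
  rw [heq]
  exact hs.hasSum

/-- **`Σ_{c ∈ ℤ/P} e^{β|c̃|}|q^P_t(c+1) − q^P_t(c)| ≤ 1260·T^{−1/2}·e^{8β²T}`** for `t > 0`, `0 ≤ β ≤ 1/32`, `T = 1 ∨ t`, uniformly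
in `P`. [folklore] -/
theorem weighted_sum_fwdDiff_torusHeatKernel_le {t : ℝ} (ht : 0 < t) {β : ℝ} (hβ0 : 0 ≤ β) (hβ : β ≤ 1 / 32) :
    ∑ c : ZMod P, Real.exp (β * |((c.valMinAbs : ℤ) : ℝ)|) * |torusHeatKernel t (c + 1) - torusHeatKernel t c|
      ≤ 1260 * (max 1 t) ^ (-(1 / 2 : ℝ)) * Real.exp (8 * β ^ 2 * max 1 t) := by
  obtain ⟨hS0, -⟩ := weighted_tsum_fwdDiff_srw_le ht (show (0 : ℝ) ≤ 1 / 32 by norm_num)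
  obtain ⟨hSw, hBw⟩ := weighted_tsum_fwdDiff_srw_le ht hβ
  have hfa : Summable fun m : ℤ => |srwHeatKernel t (m + 1) - srwHeatKernel t m| := by simpa using hS0
  refine le_trans ?_ hBw
  refine sum_weight_abs_periodic_le (fun m : ℤ => Real.exp (β * |(m : ℝ)|))
    (fun m => srwHeatKernel t (m + 1) - srwHeatKernel t m) (fun c => torusHeatKernel t (c + 1) - torusHeatKernel t c)
    (fun m => (Real.exp_pos _).le) (fun c k => expWeight_mono hβ0 c k) hfa hSw fun c => ?_
  obtain ⟨hs, heq⟩ := torusHeatKernel_eq_tsum (L := P) ht c.valMinAbs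
  obtain ⟨hs1, heq1⟩ := torusHeatKernel_eq_tsum (L := P) ht (c.valMinAbs + 1)
  rw [ZMod.coe_valMinAbs] at heq
  have hc1 : (((c.valMinAbs + 1 : ℤ)) : ZMod P) = c + 1 := by push_cast; simp
  rw [hc1] at heq1
  have hshift : (fun w : ℤ => srwHeatKernel t (c.valMinAbs + 1 + w * P)) = fun w => srwHeatKernel t (c.valMinAbs + w * P + 1) := by
    funext w; ring_nf
  rw [hshift] at hs1 heq1
  rw [heq, heq1, ← Summable.tsum_sub hs1 hs]
  exact (hs1.sub hs).hasSum

end TorusKernel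

/-! ## §3  Blocks: the reverse distance dictionary and block-localised weighted bounds -/
section Blocks

variable {P Q n : ℕ} [NeZero Q]

/-- **The reverse per-coordinate distance dictionary**: `n·|βx − βz|_Q ≤ |x − z|_P + (n − 1)` for `P = Q·n` — two residues
whose blocks are far apart are far apart (companion of `SliceTorusBlocks.pabs_sub_le_blockOf`). [folklore] -/
theorem mul_pabs_blockOf_sub_le [NeZero P] (hP : P = Q * n) (x z : ZMod P) :
    (n : ℤ) * pabs (blockOf Q n x - blockOf Q n z) ≤ pabs (x - z) + ((n : ℤ) - 1) := by
  have hn : 0 < n := pos_of_mul_eq hP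
  set qx := x.val / n with hqx
  set qz := z.val / n with hqz
  set v : ℤ := (x - z).valMinAbs with hv
  have hpv : pabs (x - z) = |v| := rfl
  -- `v ≡ x.val − z.val (mod P)`
  have hcast : ((((x.val : ℤ) - z.val : ℤ)) : ZMod P) = ((v : ℤ) : ZMod P) := by
    rw [hv, ZMod.coe_valMinAbs]; push_cast; rw [ZMod.natCast_zmod_val, ZMod.natCast_zmod_val]
  obtain ⟨k, hk⟩ := exists_eq_add_mul_of_cast_eq hcast
  have hxdm : (x.val : ℤ) = n * qx + (x.val % n : ℕ) := by
    have := Nat.div_add_mod x.val n; push_cast; rw [hqx]; exact_mod_cast this.symm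
  have hzdm : (z.val : ℤ) = n * qz + (z.val % n : ℕ) := by
    have := Nat.div_add_mod z.val n; push_cast; rw [hqz]; exact_mod_cast this.symm
  have hPz : (P : ℤ) = Q * n := by exact_mod_cast hP
  -- the block difference is represented by `qx − qz + kQ`
  have hbcast : ((((qx : ℤ) - qz + k * Q : ℤ)) : ZMod Q) = blockOf Q n x - blockOf Q n z := by
    unfold blockOf; push_cast; rw [ZMod.natCast_self, mul_zero, add_zero]
  have hb : pabs (blockOf Q n x - blockOf Q n z) ≤ |(qx : ℤ) - qz + k * Q| := pabs_le_abs_of_cast_eq hbcast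
  have hv' : v = n * ((qx : ℤ) - qz + k * Q) + (((x.val % n : ℕ) : ℤ) - ((z.val % n : ℕ) : ℤ)) := by
    rw [hk, hxdm, hzdm, hPz]; ring
  have hr : |((x.val % n : ℕ) : ℤ) - ((z.val % n : ℕ) : ℤ)| ≤ (n : ℤ) - 1 := by
    have h₁ := Nat.mod_lt x.val hn
    have h₂ := Nat.mod_lt z.val hn
    rw [abs_le]; constructor <;> omega
  have hn0 : (0 : ℤ) ≤ n := by positivity
  calc (n : ℤ) * pabs (blockOf Q n x - blockOf Q n z) ≤ (n : ℤ) * |(qx : ℤ) - qz + k * Q| :=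
        mul_le_mul_of_nonneg_left hb hn0
    _ = |(n : ℤ) * ((qx : ℤ) - qz + k * Q)| := by rw [abs_mul, abs_of_nonneg hn0]
    _ = |v - (((x.val % n : ℕ) : ℤ) - ((z.val % n : ℕ) : ℤ))| := by rw [hv']; ring_nf
    _ ≤ |v| + |((x.val % n : ℕ) : ℤ) - ((z.val % n : ℕ) : ℤ)| := abs_sub _ _
    _ ≤ pabs (x - z) + ((n : ℤ) - 1) := by rw [hpv]; linarith

/-- **Block-localised form of a weighted bound**: for a kernel `K` on `ℤ/P`, `P = Q·n`, a row `x` and a block `b`,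
`Σ_{c : βc = b} |K(x − c)| ≤ e^{α}·e^{−α·|βx − b|_Q}·Σ_c e^{(α/n)|c̃|}|K(c)|` (`α ≥ 0`): the weight of slope `α/n` pays for
exponential decay of slope `α` in the integer block distance. [folklore] -/
theorem blockSum_le_weighted [NeZero P] (hP : P = Q * n) (K : ZMod P → ℝ) (x : ZMod P) (b : ZMod Q) {α : ℝ} (hα : 0 ≤ α) :
    ∑ c ∈ Finset.univ.filter (fun c : ZMod P => blockOf Q n c = b), |K (x - c)|
      ≤ Real.exp α * Real.exp (-(α * (pabs (blockOf Q n x - b) : ℝ))) *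
        ∑ c : ZMod P, Real.exp (α / n * |((c.valMinAbs : ℤ) : ℝ)|) * |K c| := by
  have hn : 0 < n := pos_of_mul_eq hP
  have hnr : (0 : ℝ) < n := by exact_mod_cast hn
  set D : ℝ := (pabs (blockOf Q n x - b) : ℝ) with hD
  have hterm : ∀ c ∈ Finset.univ.filter (fun c : ZMod P => blockOf Q n c = b),
      |K (x - c)| ≤ Real.exp α * Real.exp (-(α * D)) * (Real.exp (α / n * |(((x - c).valMinAbs : ℤ) : ℝ)|) * |K (x - c)|) := by
    intro c hc
    have hcb : blockOf Q n c = b := (Finset.mem_filter.1 hc).2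
    have h1 := mul_pabs_blockOf_sub_le hP x c
    rw [hcb] at h1
    have h1r : (n : ℝ) * D ≤ (pabs (x - c) : ℝ) + ((n : ℝ) - 1) := by rw [hD]; exact_mod_cast h1
    have hpabs : (pabs (x - c) : ℝ) = |(((x - c).valMinAbs : ℤ) : ℝ)| := by
      rw [← Int.cast_abs]; rfl
    have hexp : 1 ≤ Real.exp α * Real.exp (-(α * D)) * Real.exp (α / n * |(((x - c).valMinAbs : ℤ) : ℝ)|) := by
      rw [← Real.exp_add, ← Real.exp_add]
      refine Real.one_le_exp ?_
      rw [← hpabs]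
      have : α * D ≤ α / n * ((pabs (x - c) : ℝ) + ((n : ℝ) - 1)) := by
        rw [div_mul_eq_mul_div, le_div_iff₀ hnr]; nlinarith
      have h2 : α / n * ((n : ℝ) - 1) ≤ α := by
        rw [div_mul_eq_mul_div, div_le_iff₀ hnr]; nlinarith
      nlinarith
    calc |K (x - c)| = 1 * |K (x - c)| := (one_mul _).symm
      _ ≤ (Real.exp α * Real.exp (-(α * D)) * Real.exp (α / n * |(((x - c).valMinAbs : ℤ) : ℝ)|)) * |K (x - c)| :=
          mul_le_mul_of_nonneg_right hexp (abs_nonneg _)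
      _ = _ := by ring
  have hnn : ∀ c ∈ (Finset.univ : Finset (ZMod P)),
      0 ≤ Real.exp (α / n * |(((x - c).valMinAbs : ℤ) : ℝ)|) * |K (x - c)| := fun c _ => by positivity
  calc ∑ c ∈ Finset.univ.filter (fun c : ZMod P => blockOf Q n c = b), |K (x - c)|
      ≤ ∑ c ∈ Finset.univ.filter (fun c : ZMod P => blockOf Q n c = b),
          Real.exp α * Real.exp (-(α * D)) * (Real.exp (α / n * |(((x - c).valMinAbs : ℤ) : ℝ)|) * |K (x - c)|) :=
        Finset.sum_le_sum hterm
    _ = Real.exp α * Real.exp (-(α * D)) * ∑ c ∈ Finset.univ.filter (fun c : ZMod P => blockOf Q n c = b),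
          Real.exp (α / n * |(((x - c).valMinAbs : ℤ) : ℝ)|) * |K (x - c)| := by rw [Finset.mul_sum]
    _ ≤ Real.exp α * Real.exp (-(α * D)) * ∑ c : ZMod P,
          Real.exp (α / n * |(((x - c).valMinAbs : ℤ) : ℝ)|) * |K (x - c)| :=
        mul_le_mul_of_nonneg_left (Finset.sum_le_sum_of_subset_of_nonneg (Finset.filter_subset _ _)
          (fun c hc _ => hnn c hc)) (by positivity)
    _ = Real.exp α * Real.exp (-(α * D)) * ∑ c : ZMod P, Real.exp (α / n * |((c.valMinAbs : ℤ) : ℝ)|) * |K c| := by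
        congr 1
        exact Fintype.sum_equiv (Equiv.subLeft x) _ _ fun c => rfl

end Blocks

/-! ## §4  The product over the coordinates of `(ℤ/P)^{d+1}` -/
section Product

variable {d P Q n : ℕ} [NeZero P] [NeZero Q]

/-- The product heat kernel of the torus `(ℤ/P)^{d+1}` at time `t` (product of the coordinate kernels; it is the kernel of
`e^{−tε}`, `ε = Σ_i(1 − cos p_i)`, by `TorusGreenHeatKernel.prod_torusHeatKernel_eq_sum`). [folklore] -/
def prodHeat (t : ℝ) (x z : Fin (d + 1) → ZMod P) : ℝ := ∏ i, torusHeatKernel t (x i - z i)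

/-- **The unit row difference of the product kernel factorises**: `H(x+e_ν,z) − H(x,z) = (q^P(x_ν−z_ν+1) − q^P(x_ν−z_ν))·
Π_{i≠ν} q^P(x_i−z_i)`. [folklore] -/
theorem prodHeat_rowDiff_eq (t : ℝ) (x z : Fin (d + 1) → ZMod P) (ν : Fin (d + 1)) :
    prodHeat t (x + Pi.single ν 1) z - prodHeat t x z
      = (torusHeatKernel t (x ν - z ν + 1) - torusHeatKernel t (x ν - z ν)) *
          ∏ i ∈ Finset.univ.erase ν, torusHeatKernel t (x i - z i) := by
  unfold prodHeat
  rw [← Finset.mul_prod_erase _ _ (Finset.mem_univ ν), ← Finset.mul_prod_erase Finset.univ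
    (fun i => torusHeatKernel t (x i - z i)) (Finset.mem_univ ν)]
  have hν : (x + Pi.single ν 1 : Fin (d + 1) → ZMod P) ν - z ν = x ν - z ν + 1 := by simp; ring
  have hrest : ∏ i ∈ Finset.univ.erase ν, torusHeatKernel t ((x + Pi.single ν 1 : Fin (d + 1) → ZMod P) i - z i)
      = ∏ i ∈ Finset.univ.erase ν, torusHeatKernel t (x i - z i) :=
    Finset.prod_congr rfl fun i hi => by rw [Pi.add_apply, Pi.single_eq_of_ne (Finset.ne_of_mem_erase hi), add_zero]
  rw [hν, hrest]; ring

omit [NeZero Q] in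
/-- The block fibre of `y₁` is the product of the coordinate block fibres. [folklore] -/
theorem filter_blockPt_eq_piFinset (y₁ : Fin (d + 1) → ZMod Q) :
    Finset.univ.filter (fun z : Fin (d + 1) → ZMod P => blockPt Q n z = y₁)
      = Fintype.piFinset fun i => Finset.univ.filter (fun c : ZMod P => blockOf Q n c = y₁ i) := by
  ext z
  simp only [Finset.mem_filter, Finset.mem_univ, true_and, Fintype.mem_piFinset]
  exact funext_iff

/-- **THE BLOCK-LOCALISED ROW-DIFFERENCE BOUND FOR THE PRODUCT HEAT KERNEL.**  On `(ℤ/P)^{d+1}` with blocks of side `n`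
(`P = Q·n`), for `t > 0`, `T = 1 ∨ t`, `0 ≤ α ≤ 1/32`, every row `x`, block `y₁` and direction `ν`:
`Σ_{z : blockPt z = y₁} |H_t(x+e_ν,z) − H_t(x,z)| ≤ 1260·48^d·e^{α(d+1)}·T^{−1/2}·e^{8(d+1)(α/n)²T}·e^{−α·npl1(blockPt x − y₁)}`.
[folklore] -/
theorem blockSum_rowDiff_prodHeat_le (hP : P = Q * n) {t : ℝ} (ht : 0 < t) {α : ℝ} (hα0 : 0 ≤ α) (hα : α ≤ 1 / 32)
    (x : Fin (d + 1) → ZMod P) (y₁ : Fin (d + 1) → ZMod Q) (ν : Fin (d + 1)) :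
    ∑ z ∈ Finset.univ.filter (fun z : Fin (d + 1) → ZMod P => blockPt Q n z = y₁),
        |prodHeat t (x + Pi.single ν 1) z - prodHeat t x z|
      ≤ 1260 * 48 ^ d * Real.exp (α * (d + 1)) * (max 1 t) ^ (-(1 / 2 : ℝ)) *
          Real.exp (8 * (d + 1) * (α / n) ^ 2 * max 1 t) * Real.exp (-(α * npl1 (blockPt Q n x - y₁))) := by
  classical
  have hn : 0 < n := pos_of_mul_eq hP
  have hn1 : (1 : ℝ) ≤ n := by exact_mod_cast hn
  obtain ⟨hT1, hT0, -, -, -⟩ := max_one_facts t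
  set T := max 1 t with hTdef
  set β : ℝ := α / n with hβdef
  have hβ0 : 0 ≤ β := div_nonneg hα0 (by positivity)
  have hβα : β ≤ α := div_le_self hα0 hn1
  have hβ32 : β ≤ 1 / 32 := hβα.trans hα
  have hβ16 : β ≤ 1 / 16 := hβ32.trans (by norm_num)
  set F : Fin (d + 1) → ZMod P → ℝ := fun i c =>
    if i = ν then |torusHeatKernel t (x i - c + 1) - torusHeatKernel t (x i - c)| else |torusHeatKernel t (x i - c)| with hF
  set Dc : Fin (d + 1) → ℝ := fun i => (pabs (blockOf Q n (x i) - y₁ i) : ℝ) with hDc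
  set bnd : Fin (d + 1) → ℝ := fun i => Real.exp α * Real.exp (-(α * Dc i)) *
    (if i = ν then 1260 * T ^ (-(1 / 2 : ℝ)) * Real.exp (8 * β ^ 2 * T) else 48 * Real.exp (4 * β ^ 2 * T)) with hbnd
  have hF0 : ∀ i c, 0 ≤ F i c := fun i c => by simp only [hF]; split_ifs <;> positivity
  have hfac : ∀ i, ∑ c ∈ Finset.univ.filter (fun c : ZMod P => blockOf Q n c = y₁ i), F i c ≤ bnd i := by
    intro i
    by_cases hi : i = ν
    · have h := blockSum_le_weighted hP (fun c => torusHeatKernel t (c + 1) - torusHeatKernel t c) (x i) (y₁ i) hα0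
      have hw := weighted_sum_fwdDiff_torusHeatKernel_le (P := P) ht hβ0 hβ32
      simp only [hF, hbnd, if_pos hi, hDc]
      refine h.trans ?_
      rw [hβdef] at hw ⊢
      exact mul_le_mul_of_nonneg_left hw (by positivity)
    · have h := blockSum_le_weighted hP (fun c => torusHeatKernel t c) (x i) (y₁ i) hα0
      have hw := weighted_sum_torusHeatKernel_le (P := P) ht hβ0 hβ16
      simp only [hF, hbnd, if_neg hi, hDc]
      refine h.trans ?_
      rw [hβdef] at hw ⊢
      exact mul_le_mul_of_nonneg_left hw (by positivity)
  have hsum : ∑ z ∈ Finset.univ.filter (fun z : Fin (d + 1) → ZMod P => blockPt Q n z = y₁),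
      |prodHeat t (x + Pi.single ν 1) z - prodHeat t x z|
      = ∏ i, ∑ c ∈ Finset.univ.filter (fun c : ZMod P => blockOf Q n c = y₁ i), F i c := by
    rw [Finset.prod_univ_sum, filter_blockPt_eq_piFinset]
    refine Finset.sum_congr rfl fun z _ => ?_
    rw [prodHeat_rowDiff_eq, abs_mul, Finset.abs_prod, ← Finset.mul_prod_erase Finset.univ (fun i => F i (z i))
      (Finset.mem_univ ν)]
    simp only [hF, if_true]
    congr 1
    exact Finset.prod_congr rfl fun i hi => by rw [if_neg (Finset.ne_of_mem_erase hi)]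
  rw [hsum]
  have hprod : ∏ i, ∑ c ∈ Finset.univ.filter (fun c : ZMod P => blockOf Q n c = y₁ i), F i c ≤ ∏ i, bnd i :=
    Finset.prod_le_prod (fun i _ => Finset.sum_nonneg fun c _ => hF0 i c) fun i _ => hfac i
  refine hprod.trans ?_
  have hsplit : ∏ i, bnd i = (∏ i : Fin (d + 1), Real.exp α) * (∏ i, Real.exp (-(α * Dc i))) *
      ∏ i, (if i = ν then 1260 * T ^ (-(1 / 2 : ℝ)) * Real.exp (8 * β ^ 2 * T) else 48 * Real.exp (4 * β ^ 2 * T)) := by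
    simp only [hbnd, Finset.prod_mul_distrib]
  have h1 : ∏ _i : Fin (d + 1), Real.exp α = Real.exp (α * (d + 1)) := by
    rw [Finset.prod_const, Finset.card_univ, Fintype.card_fin, ← Real.exp_nat_mul]; push_cast; ring_nf
  have h2 : ∏ i, Real.exp (-(α * Dc i)) = Real.exp (-(α * npl1 (blockPt Q n x - y₁))) := by
    rw [← Real.exp_sum, cast_npl1, pl1_eq_sum, Finset.mul_sum, ← Finset.sum_neg_distrib]
    rfl
  have h3 : ∏ i, (if i = ν then 1260 * T ^ (-(1 / 2 : ℝ)) * Real.exp (8 * β ^ 2 * T) else 48 * Real.exp (4 * β ^ 2 * T))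
      = 1260 * T ^ (-(1 / 2 : ℝ)) * Real.exp (8 * β ^ 2 * T) * (48 * Real.exp (4 * β ^ 2 * T)) ^ d := by
    rw [← Finset.mul_prod_erase _ _ (Finset.mem_univ ν), if_pos rfl]
    congr 1
    rw [Finset.prod_congr rfl fun i hi => if_neg (Finset.ne_of_mem_erase hi), Finset.prod_const,
      Finset.card_erase_of_mem (Finset.mem_univ ν), Finset.card_univ, Fintype.card_fin, Nat.add_sub_cancel]
  have hkey : Real.exp (8 * β ^ 2 * T) * Real.exp (4 * β ^ 2 * T) ^ d ≤ Real.exp (8 * (d + 1) * (α / n) ^ 2 * T) := by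
    rw [← Real.exp_nat_mul, ← Real.exp_add, hβdef]
    refine Real.exp_le_exp.2 ?_
    have : 0 ≤ (α / n) ^ 2 * T := by positivity
    nlinarith [(Nat.cast_nonneg d : (0:ℝ) ≤ d)]
  set A : ℝ := 1260 * 48 ^ d * Real.exp (α * (d + 1)) * T ^ (-(1 / 2 : ℝ)) * Real.exp (-(α * npl1 (blockPt Q n x - y₁)))
    with hA
  have hA0 : 0 ≤ A := by rw [hA]; positivity
  calc ∏ i, bnd i = A * (Real.exp (8 * β ^ 2 * T) * Real.exp (4 * β ^ 2 * T) ^ d) := by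
        rw [hsplit, h1, h2, h3, hA, mul_pow]; ring
    _ ≤ A * Real.exp (8 * (d + 1) * (α / n) ^ 2 * T) := mul_le_mul_of_nonneg_left hkey hA0
    _ = _ := by rw [hA]; ring

end Product

end Summit.QuantumFields.BalabanUV.T4Continuum.SliceFlatHeatTorus
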